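import Summits.CriticalPhenomena.PercolationContinuityZ3.Theses.PercLowPointHalfSpace
import Summits.CriticalPhenomena.PercolationContinuityZ3.Theorems.BoundaryTwoArmDecay.Negative.LoadBearing
import Summits.CriticalPhenomena.PercolationContinuityZ3.Theorems.QuantitativeBGN.Negative.LoadBearing
import Summits.CriticalPhenomena.PercolationContinuityZ3.Theorems.PercLowPointHalfSpaceBoundaryTwoArmDecayStubDecoupling
import Literature.Probability.Percolation.LatticeSymmetry
import Literature.Probability.Percolation.RSW

/-!
# Skeleton of line `Sketch` (= `exploration-decoupled-avoidance-split`, ideator 1) for crux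
# `PercLowPointHalfSpace.BoundaryTwoArmDecay` (stmt-CriticalPhenomena-0911)

Lead's skeleton (prover-line-stmt-CriticalPhenomena-0911-0), reshaped from the planner's checked
`SketchIdeator1.lean` (evidence `20260816T022423Z-Sketch.lean`): the planner's file only NAMED the transfer
targets (`DecouplingIdentity`, `BoundaryOneArmRate a`, `ConditionalRepulsion λ`, `AvoidanceSplit`); here they
become three registered stubs with fully INLINED signatures in tree vocabulary (so each lands under `Theorems/`
with no new definition) and a PROVED composition `BoundaryTwoArmDecay_of` concluding the crux decl by name.

Crux (A): `∃ κ C, 0 < κ ∧ ∀ r ≥ 1, P_{p_c(ℤ³)}(E r) ≤ C r^{-(5/2+κ)}`,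
`E r = {arm_ℍ(0,r) ∧ arm_ℍ(e,r) ∧ 0 ↮_ℍ e}` (landed `Negative.E`, `Negative.boundaryTwoArmDecay_iff : … ↔ …` by `Iff.rfl`),
`ℍ = {x | 0 ≤ x 0}`, `e = Pi.single 1 1`.

## The line (all probabilities at `p = p_c(ℤ³)`; `A(ω) := C_ℍ(0)[ω] = {v | ω ∈ openConnIn ℍ 0 v}`)

  `P(E r) ≤ ∫ 1{arm_ℍ(0,r)}(ω) · P(arm of e to r inside ℍ ∖ A(ω)) dP(ω)`      STUB `stub_decoupling`
      (L — LANDED p90994 `Theorems.BoundaryTwoArmDecay.stub_decoupling`, wave 1: exploration of `A` is a stopping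
       set, `Literature/Probability/Percolation/ClusterExplorationDecoupling.lean` p88050; `n → ∞` monotone
       convergence; `m → ∞` by BGN a.s. finiteness `ae_finite_openClusterIn_halfSpace_criticalProbI`)
  `∫ 1{arm}(ω) P(arm of e in ℍ∖A(ω)) dP ≤ P(arm_ℍ(0,r))²`                          STUB `stub_baseline` (λ₀ = 0)
      (S — LANDED p91688 `Theorems.BoundaryTwoArmDecay.stub_baseline`, the lead's: domain monotonicity ℍ∖A ⊆ ℍ +
       horizontal shift by `e`; with `stub_decoupling`
       it certifies the BK-type bound `P(E r) ≤ P(arm_ℍ(0,r))²`, i.e. a₂ ≥ 2a₁ — `twoArm_le_arm_sq` below — and pins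
       the research content of the line to the power GAIN λ₀ > 1/2 over this baseline; not in the composition cone)
  `∫ 1{arm}(ω) P(arm of e in ℍ∖A(ω)) dP ≤ C r^{-4/5} P(arm_ℍ(0,r))²`             STUB `stub_deficiency` (λ₀ = 4/5)
      (XL, OPEN, HARDEST — the line's load-bearing content: "for P-typical tall A ∋ 0 the boundary arm of ℍ∖A at e
       is deficient by r^{-λ₀}"; λ₀ = 0 is BK; no engine known — TransverseCrossingsNeedNotMeet in probabilistic form;
       the lead's)
  `P(arm_ℍ(0,r)) ≤ C r^{-7/8}`                                                  STUB `stub_oneArmRate` (a₀ = 7/8)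
      (XL, OPEN — crux C = stmt-CriticalPhenomena-0913 sharpened from "some a > 0" to a = 7/8 ≈ 0.9 x_s;
       rigorously 0 < a ≤ 2 is the admissible window, `Negative.quantitativeBGN_exponent_le_two`)

`BoundaryTwoArmDecay_of : stub_decoupling → stub_deficiency → stub_oneArmRate → BoundaryTwoArmDecay` (PROVED:
`P(E r) ≤ C₀ r^{-4/5} (C₁ r^{-7/8})² = C₀C₁² r^{-(5/2 + 1/20)}`, `κ = 2a₀ + λ₀ − 5/2 = 1/20`).
Split (a₀, λ₀) = (7/8, 4/5) chosen inside the numerically true region (a₁ = 0.975 ± 0.01, λ = a₂ − 2a₁ = 1.05 ± 0.1,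
Disproof MC a₂ = 3.0 ± 0.1): margins 0.10 and 0.25.

## Disproof used (`Cruxes/BoundaryTwoArmDecay/Disproof.lean` v3; landed `Negative/OneArmLowerBound.lean`, `Negative/LoadBearing.lean`)
`…_false_without_r_ge_one`: every stub carries `1 ≤ r`. `…_false_without_disjoint`: disjointness enters `stub_deficiency`
exactly through the removed domain `A(ω)` (with nothing removed the deficiency integral is `P(arm)·P(arm)`, λ₀ = 0 — the
refuted strengthening is not instantiated). `…_false_without_second_arm`: the second arm is the arm of `e` in ℍ∖A.
`quantitativeBGN_exponent_le_two`: a₀ = 7/8 ≤ 2. Targets §(d): none yet. No stub instantiates a landed Negative lemma.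
-/

noncomputable section

namespace Summit.CriticalPhenomena.PercolationContinuityZ3.Cruxes.BoundaryTwoArmDecay.AvoidanceSplit

open MeasureTheory Filter Topology
open scoped ENNReal
open Literature.Probability.Percolation Literature.Probability.LatticeModels
open Summit.CriticalPhenomena.PercolationContinuityZ3.Theorems.BoundaryTwoArmDecay.Negative
  (H e μ E boundaryTwoArmDecay_iff)
open Summit.CriticalPhenomena.PercolationContinuityZ3.Theses.PercLowPointHalfSpace (BoundaryTwoArmDecay)

/-! ### Objects (tree vocabulary) -/

/-- `arm_ℍ(0,r)`: the half-space cluster of `0` reaches sup-distance `≥ r` (verbatim the set of item C and the first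
conjunct of `E r`; equal to the landed `QuantitativeBGN.Negative.armH r`). -/
abbrev arm0 (r : ℕ) : Set (BondConfig (Site 3)) :=
  {ω | ∃ y : Site 3, (∃ i : Fin 3, (r : ℤ) ≤ |y i|) ∧ ω ∈ openConnIn H 0 y}

/-- `A(ω) = C_ℍ(0)[ω]`: the half-space cluster of the origin as a vertex set. -/
abbrev clusterH (ω : BondConfig (Site 3)) : Set (Site 3) := {v | ω ∈ openConnIn H 0 v}

/-- The AVOIDING arm: `e` reaches sup-distance `≥ r` (from `e`) inside the random domain `ℍ ∖ A(ω)`; an event in the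
fresh configuration `ω'`. -/
abbrev avoidArm (r : ℕ) (ω : BondConfig (Site 3)) : Set (BondConfig (Site 3)) :=
  {ω' | ∃ y : Site 3, (∃ i : Fin 3, (r : ℤ) ≤ |y i - e i|) ∧ ω' ∈ openConnIn (H \ clusterH ω) e y}

/-- The DEFICIENCY INTEGRAL `∫ 1{arm_ℍ(0,r)}(ω) · P(avoidArm r ω) dP(ω)`. -/
def defInt (r : ℕ) : ℝ≥0∞ := ∫⁻ ω, (arm0 r).indicator (fun _ => (1 : ℝ≥0∞)) ω * μ (avoidArm r ω) ∂μ

/-! ### The three statements (named `Prop`s) -/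

/-- STUB 1 statement (DECOUPLING, provable now): `P(E r) ≤ defInt r` for `r ≥ 1`. -/
def DecouplingBound : Prop := ∀ r : ℕ, 1 ≤ r → μ (E r) ≤ defInt r

/-- STUB 2 statement (DEFICIENCY `λ`, open, hardest): `defInt r ≤ C r^{-λ} P(arm_ℍ(0,r))²` for `r ≥ 1`. -/
def Deficiency (lam : ℝ) : Prop :=
  ∃ C : ℝ, ∀ r : ℕ, 1 ≤ r → defInt r ≤ ENNReal.ofReal (C * (r : ℝ) ^ (-lam)) * μ (arm0 r) ^ 2

/-- STUB 3 statement (ONE-ARM RATE `a`, open): `P(arm_ℍ(0,r)) ≤ C r^{-a}` for `r ≥ 1`. -/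
def OneArmRate (a : ℝ) : Prop := ∃ C : ℝ, ∀ r : ℕ, 1 ≤ r → μ.real (arm0 r) ≤ C * (r : ℝ) ^ (-a)

/-- STUB 1b statement (BASELINE, λ₀ = 0): `defInt r ≤ P(arm_ℍ(0,r))²` for `r ≥ 1`. -/
def Baseline : Prop := ∀ r : ℕ, 1 ≤ r → defInt r ≤ μ (arm0 r) ^ 2

/-! ### The baseline proof (verbatim the landed `Theorems/PercLowPointHalfSpaceBoundaryTwoArmDecayStubBaseline.lean`,
p91688; repeated here so that this workfile does not depend on that module) -/
namespace BaselineLocal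

open Summit.CriticalPhenomena.PercolationContinuityZ3.Theorems.QuantitativeBGN.Negative (armH measurableSet_armH)
open Summit.CriticalPhenomena.PercolationContinuityZ3.Theorems.BoundaryTwoArmDecay.Negative (far)

/-- Domain monotonicity: the avoiding arm of `e` implies the arm of `e` in the whole half-space. -/
theorem avoidArm_subset_armE (r : ℕ) (ω : BondConfig (Site 3)) :
    avoidArm r ω ⊆ {ω' | ∃ y : Site 3, (∃ i : Fin 3, (r : ℤ) ≤ |y i - e i|) ∧ ω' ∈ openConnIn H e y} := by
  rintro ω' ⟨y, hy, hω'⟩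
  exact ⟨y, hy, openConnIn_mono Set.sdiff_subset _ _ hω'⟩

/-- `arm_ℍ(0,r)` is measurable (landed as `QuantitativeBGN.Negative.measurableSet_armH`, same set). -/
theorem measurableSet_arm0 (r : ℕ) : MeasurableSet (arm0 r) := measurableSet_armH r

/-- `arm_ℍ(0,r)` as an open crossing event. -/
theorem arm0_eq_openCrossing (r : ℕ) : arm0 r = openCrossing H {0} (far r) := by
  ext ω
  simp only [far, mem_openCrossing_iff, Set.mem_singleton_iff, exists_eq_left, Set.mem_setOf_eq]

/-- `arm_ℍ(e,r)` is the translate by `e` of `{0} ⟷ far r` in `ℍ`. -/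
theorem armE_eq_openCrossing_shift (r : ℕ) :
    {ω' : BondConfig (Site 3) | ∃ y : Site 3, (∃ i : Fin 3, (r : ℤ) ≤ |y i - e i|) ∧ ω' ∈ openConnIn H e y} =
      openCrossing ((· + e) '' H) ((· + e) '' {0}) ((· + e) '' far r) := by
  have hH : ((· + e) '' H : Set (Site 3)) = H := by
    ext y
    simp only [Set.mem_image, Set.mem_setOf_eq]
    constructor
    · rintro ⟨z, hz, rfl⟩
      simpa [e] using hz
    · intro hy
      exact ⟨y - e, by simpa [e] using hy, sub_add_cancel y e⟩
  have h0 : ((· + e) '' {0} : Set (Site 3)) = {e} := by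
    rw [Set.image_singleton, zero_add]
  have hfar : ((· + e) '' far r : Set (Site 3)) = {y | ∃ i : Fin 3, (r : ℤ) ≤ |y i - e i|} := by
    ext y
    simp only [far, Set.mem_image, Set.mem_setOf_eq]
    constructor
    · rintro ⟨z, ⟨i, hi⟩, rfl⟩
      exact ⟨i, by simpa using hi⟩
    · rintro ⟨i, hi⟩
      exact ⟨y - e, ⟨i, by simpa using hi⟩, sub_add_cancel y e⟩
  rw [hH, h0, hfar]
  ext ω
  simp only [mem_openCrossing_iff, Set.mem_singleton_iff, exists_eq_left, Set.mem_setOf_eq]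

/-- Shift invariance: `P(arm_ℍ(e,r)) = P(arm_ℍ(0,r))`. -/
theorem measure_armE_eq (r : ℕ) :
    μ {ω' : BondConfig (Site 3) | ∃ y : Site 3, (∃ i : Fin 3, (r : ℤ) ≤ |y i - e i|) ∧ ω' ∈ openConnIn H e y} =
      μ (arm0 r) := by
  have hreal : μ.real {ω' : BondConfig (Site 3) | ∃ y : Site 3, (∃ i : Fin 3, (r : ℤ) ≤ |y i - e i|) ∧
      ω' ∈ openConnIn H e y} = μ.real (arm0 r) := by
    rw [armE_eq_openCrossing_shift, arm0_eq_openCrossing]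
    exact real_openCrossing_shift (criticalProbI 3) e H {0} (far r)
  exact (ENNReal.toReal_eq_toReal_iff' (measure_ne_top _ _) (measure_ne_top _ _)).1 hreal

/-- The baseline bound: `defInt r ≤ P(arm_ℍ(0,r))²`. -/
theorem defInt_le (r : ℕ) : defInt r ≤ μ (arm0 r) ^ 2 := by
  have hmeas : Measurable fun ω => (arm0 r).indicator (fun _ => (1 : ℝ≥0∞)) ω :=
    measurable_const.indicator (measurableSet_arm0 r)
  calc defInt r
      ≤ ∫⁻ ω, (arm0 r).indicator (fun _ => (1 : ℝ≥0∞)) ω *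
          μ {ω' : BondConfig (Site 3) | ∃ y : Site 3, (∃ i : Fin 3, (r : ℤ) ≤ |y i - e i|) ∧
            ω' ∈ openConnIn H e y} ∂μ := by
        refine lintegral_mono fun ω => ?_
        exact mul_le_mul' le_rfl (measure_mono (avoidArm_subset_armE r ω))
    _ = (∫⁻ ω, (arm0 r).indicator (fun _ => (1 : ℝ≥0∞)) ω ∂μ) *
          μ {ω' : BondConfig (Site 3) | ∃ y : Site 3, (∃ i : Fin 3, (r : ℤ) ≤ |y i - e i|) ∧
            ω' ∈ openConnIn H e y} :=
        lintegral_mul_const _ hmeas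
    _ = μ (arm0 r) * μ (arm0 r) := by
        rw [lintegral_indicator_const (measurableSet_arm0 r), one_mul, measure_armE_eq]
    _ = μ (arm0 r) ^ 2 := (sq _).symm

end BaselineLocal

/-! ### Registered stubs (the ONLY `sorry`s of this file; signatures fully inlined in tree vocabulary) -/

/-- STUB 1 (L, PROVABLE NOW) — stopping-set decoupling of the exploration of `C_ℍ(0)`. -/
theorem stub_decoupling :
    ∀ r : ℕ, 1 ≤ r →
      (bondPercolation (zdGraph 3) (criticalProbI 3))
          {ω | (∃ y : Site 3, (∃ i : Fin 3, (r : ℤ) ≤ |y i|) ∧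
                ω ∈ openConnIn {x : Site 3 | 0 ≤ x 0} 0 y) ∧
              (∃ y : Site 3, (∃ i : Fin 3, (r : ℤ) ≤ |y i - (Pi.single 1 1 : Site 3) i|) ∧
                ω ∈ openConnIn {x : Site 3 | 0 ≤ x 0} (Pi.single 1 1 : Site 3) y) ∧
              ω ∉ openConnIn {x : Site 3 | 0 ≤ x 0} 0 (Pi.single 1 1 : Site 3)} ≤
        ∫⁻ ω, {ω : BondConfig (Site 3) | ∃ y : Site 3, (∃ i : Fin 3, (r : ℤ) ≤ |y i|) ∧
                  ω ∈ openConnIn {x : Site 3 | 0 ≤ x 0} 0 y}.indicator (fun _ => (1 : ℝ≥0∞)) ω *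
              (bondPercolation (zdGraph 3) (criticalProbI 3))
                {ω' | ∃ y : Site 3, (∃ i : Fin 3, (r : ℤ) ≤ |y i - (Pi.single 1 1 : Site 3) i|) ∧
                  ω' ∈ openConnIn ({x : Site 3 | 0 ≤ x 0} \ {v | ω ∈ openConnIn {x : Site 3 | 0 ≤ x 0} 0 v})
                    (Pi.single 1 1 : Site 3) y}
          ∂(bondPercolation (zdGraph 3) (criticalProbI 3)) :=
  _root_.Summit.CriticalPhenomena.PercolationContinuityZ3.Theorems.BoundaryTwoArmDecay.stub_decoupling

/-- STUB 1b (S, PROVABLE NOW; the lead's) — the λ₀ = 0 end of the split: the deficiency integral is at most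
`P(arm_ℍ(0,r))·P(arm_ℍ(e,r)) = P(arm_ℍ(0,r))²` (domain monotonicity + shift invariance). Baseline / necessity side:
NOT a hypothesis of `BoundaryTwoArmDecay_of`. -/
theorem stub_baseline :
    ∀ r : ℕ, 1 ≤ r →
      ∫⁻ ω, {ω : BondConfig (Site 3) | ∃ y : Site 3, (∃ i : Fin 3, (r : ℤ) ≤ |y i|) ∧
                ω ∈ openConnIn {x : Site 3 | 0 ≤ x 0} 0 y}.indicator (fun _ => (1 : ℝ≥0∞)) ω *
            (bondPercolation (zdGraph 3) (criticalProbI 3))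
              {ω' | ∃ y : Site 3, (∃ i : Fin 3, (r : ℤ) ≤ |y i - (Pi.single 1 1 : Site 3) i|) ∧
                ω' ∈ openConnIn ({x : Site 3 | 0 ≤ x 0} \ {v | ω ∈ openConnIn {x : Site 3 | 0 ≤ x 0} 0 v})
                  (Pi.single 1 1 : Site 3) y}
        ∂(bondPercolation (zdGraph 3) (criticalProbI 3)) ≤
      (bondPercolation (zdGraph 3) (criticalProbI 3))
          {ω | ∃ y : Site 3, (∃ i : Fin 3, (r : ℤ) ≤ |y i|) ∧
            ω ∈ openConnIn {x : Site 3 | 0 ≤ x 0} 0 y} ^ 2 :=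
  fun r _ => BaselineLocal.defInt_le r

/-- STUB 2 (XL, OPEN, HARDEST; the lead's) — deficiency exponent `λ₀ = 4/5` of the random domain `ℍ ∖ C_ℍ(0)` at `e`. -/
theorem stub_deficiency :
    ∃ C : ℝ, ∀ r : ℕ, 1 ≤ r →
      ∫⁻ ω, {ω : BondConfig (Site 3) | ∃ y : Site 3, (∃ i : Fin 3, (r : ℤ) ≤ |y i|) ∧
                ω ∈ openConnIn {x : Site 3 | 0 ≤ x 0} 0 y}.indicator (fun _ => (1 : ℝ≥0∞)) ω *
            (bondPercolation (zdGraph 3) (criticalProbI 3))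
              {ω' | ∃ y : Site 3, (∃ i : Fin 3, (r : ℤ) ≤ |y i - (Pi.single 1 1 : Site 3) i|) ∧
                ω' ∈ openConnIn ({x : Site 3 | 0 ≤ x 0} \ {v | ω ∈ openConnIn {x : Site 3 | 0 ≤ x 0} 0 v})
                  (Pi.single 1 1 : Site 3) y}
        ∂(bondPercolation (zdGraph 3) (criticalProbI 3)) ≤
      ENNReal.ofReal (C * (r : ℝ) ^ (-(4 / 5 : ℝ))) *
        (bondPercolation (zdGraph 3) (criticalProbI 3))
          {ω | ∃ y : Site 3, (∃ i : Fin 3, (r : ℤ) ≤ |y i|) ∧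
            ω ∈ openConnIn {x : Site 3 | 0 ≤ x 0} 0 y} ^ 2 := by
  sorry

/-- STUB 3 (XL, OPEN) — boundary one-arm RATE `a₀ = 7/8` at `p_c(ℤ³)` (crux C sharpened). -/
theorem stub_oneArmRate :
    ∃ C : ℝ, ∀ r : ℕ, 1 ≤ r →
      (bondPercolation (zdGraph 3) (criticalProbI 3)).real
          {ω | ∃ y : Site 3, (∃ i : Fin 3, (r : ℤ) ≤ |y i|) ∧
            ω ∈ openConnIn {x : Site 3 | 0 ≤ x 0} 0 y} ≤ C * (r : ℝ) ^ (-(7 / 8 : ℝ)) := by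
  sorry

/-! ### Consistency: each named statement IS its registered stub (definitionally) -/

theorem decouplingBound_holds : DecouplingBound := stub_decoupling
theorem deficiency_holds : Deficiency (4 / 5) := stub_deficiency
theorem oneArmRate_holds : OneArmRate (7 / 8) := stub_oneArmRate
theorem baseline_holds : Baseline := stub_baseline

/-- **BK-type bound from the two provable stubs** (`stub_decoupling`, landed, + `stub_baseline`):
`P(E r) ≤ P(arm_ℍ(0,r))²` for `r ≥ 1`, i.e. a₂ ≥ 2a₁ rigorously; the line's research content is the GAIN over it. -/
theorem twoArm_le_arm_sq {r : ℕ} (hr : 1 ≤ r) : μ (E r) ≤ μ (arm0 r) ^ 2 :=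
  (decouplingBound_holds r hr).trans (baseline_holds r hr)

/-! ### Name-keyed aliases (hypotheses of the composition) -/
namespace Registered

/-- Alias of `DecouplingBound` keyed by the registered stub name. -/
abbrev stub_decoupling : Prop := DecouplingBound
/-- Alias of `Deficiency (4/5)` keyed by the registered stub name. -/
abbrev stub_deficiency : Prop := Deficiency (4 / 5)
/-- Alias of `OneArmRate (7/8)` keyed by the registered stub name. -/
abbrev stub_oneArmRate : Prop := OneArmRate (7 / 8)
/-- Alias of `Baseline` keyed by the registered stub name (not a hypothesis of the composition). -/
abbrev stub_baseline : Prop := Baseline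

end Registered

/-! ### Glue (PROVED): exponent algebra `2a + λ > 5/2 ⇒ A` -/

/-- From the decoupling bound and a deficiency with constant `C`: `P(E r) ≤ max C 0 · r^{-λ} · P(arm)²` (real form). -/
theorem real_E_le_of_deficiency {lam C : ℝ} (hdec : DecouplingBound)
    (hdef : ∀ r : ℕ, 1 ≤ r → defInt r ≤ ENNReal.ofReal (C * (r : ℝ) ^ (-lam)) * μ (arm0 r) ^ 2)
    {r : ℕ} (hr : 1 ≤ r) :
    μ.real (E r) ≤ max C 0 * (r : ℝ) ^ (-lam) * μ.real (arm0 r) ^ 2 := by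
  have hr0 : (0 : ℝ) < r := by exact_mod_cast hr
  have hrpow : 0 ≤ (r : ℝ) ^ (-lam) := Real.rpow_nonneg hr0.le _
  have h1 : μ (E r) ≤ ENNReal.ofReal (max C 0 * (r : ℝ) ^ (-lam)) * μ (arm0 r) ^ 2 := by
    refine (hdec r hr).trans ((hdef r hr).trans ?_)
    gcongr
    exact le_max_left _ _
  have hne : ENNReal.ofReal (max C 0 * (r : ℝ) ^ (-lam)) * μ (arm0 r) ^ 2 ≠ ∞ :=
    ENNReal.mul_ne_top ENNReal.ofReal_ne_top (ENNReal.pow_ne_top (measure_ne_top _ _))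
  have h2 := (ENNReal.toReal_le_toReal (measure_ne_top _ _) hne).2 h1
  rw [ENNReal.toReal_mul, ENNReal.toReal_pow, ENNReal.toReal_ofReal (mul_nonneg (le_max_right _ _) hrpow)]
    at h2
  exact h2

/-- **Exponent algebra.** `DecouplingBound`, `Deficiency λ` and `OneArmRate a` with `5/2 < 2a + λ` give the decay
of the crux (unfolded form; `κ = 2a + λ - 5/2`, `C = max C₀ 0 · C₁²`). -/
theorem decay_of_exponents {a lam : ℝ} (h : 5 / 2 < 2 * a + lam) (hdec : DecouplingBound)
    (hdef : Deficiency lam) (harm : OneArmRate a) :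
    ∃ κ C : ℝ, 0 < κ ∧ ∀ r : ℕ, 1 ≤ r → μ.real (E r) ≤ C * (r : ℝ) ^ (-(5 / 2 + κ)) := by
  obtain ⟨C₀, hC₀⟩ := hdef
  obtain ⟨C₁, hC₁⟩ := harm
  refine ⟨2 * a + lam - 5 / 2, max C₀ 0 * C₁ ^ 2, by linarith, fun r hr => ?_⟩
  have hr0 : (0 : ℝ) < r := by exact_mod_cast hr
  have hE := real_E_le_of_deficiency hdec hC₀ hr
  have hP0 : 0 ≤ μ.real (arm0 r) := measureReal_nonneg
  have hP1 : μ.real (arm0 r) ≤ C₁ * (r : ℝ) ^ (-a) := hC₁ r hr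
  have hsq : μ.real (arm0 r) ^ 2 ≤ (C₁ * (r : ℝ) ^ (-a)) ^ 2 := pow_le_pow_left₀ hP0 hP1 2
  have hrl : 0 ≤ (r : ℝ) ^ (-lam) := Real.rpow_nonneg hr0.le _
  have hexp : (r : ℝ) ^ (-lam) * ((r : ℝ) ^ (-a)) ^ 2 = (r : ℝ) ^ (-(5 / 2 + (2 * a + lam - 5 / 2))) := by
    rw [← Real.rpow_natCast, ← Real.rpow_mul hr0.le, ← Real.rpow_add hr0]
    congr 1; push_cast; ring
  calc μ.real (E r) ≤ max C₀ 0 * (r : ℝ) ^ (-lam) * μ.real (arm0 r) ^ 2 := hE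
    _ ≤ max C₀ 0 * (r : ℝ) ^ (-lam) * (C₁ * (r : ℝ) ^ (-a)) ^ 2 := by
        exact mul_le_mul_of_nonneg_left hsq (mul_nonneg (le_max_right _ _) hrl)
    _ = max C₀ 0 * C₁ ^ 2 * ((r : ℝ) ^ (-lam) * ((r : ℝ) ^ (-a)) ^ 2) := by ring
    _ = max C₀ 0 * C₁ ^ 2 * (r : ℝ) ^ (-(5 / 2 + (2 * a + lam - 5 / 2))) := by rw [hexp]

/-! ### The composition: the three stubs imply the crux, by name -/

/-- **`BoundaryTwoArmDecay` from the three stubs** (no `sorry` outside the stubs): `2·(7/8) + 4/5 = 51/20 > 5/2`. -/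
theorem BoundaryTwoArmDecay_of (h₁ : Registered.stub_decoupling) (h₂ : Registered.stub_deficiency)
    (h₃ : Registered.stub_oneArmRate) : BoundaryTwoArmDecay :=
  boundaryTwoArmDecay_iff.mpr (decay_of_exponents (a := 7 / 8) (lam := 4 / 5) (by norm_num) h₁ h₂ h₃)

/-- Wiring check: the registered stubs feed `BoundaryTwoArmDecay_of` as stated. -/
theorem BoundaryTwoArmDecay_proof : BoundaryTwoArmDecay :=
  BoundaryTwoArmDecay_of stub_decoupling stub_deficiency stub_oneArmRate

end Summit.CriticalPhenomena.PercolationContinuityZ3.Cruxes.BoundaryTwoArmDecay.AvoidanceSplit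

end
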